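import Summits.FinalStateConjecture.FinalStateConjecture.Theorems.EIHFluxBalanceInertialRecessionSlavingFarFieldRowsB
import Summits.FinalStateConjecture.FinalStateConjecture.Theorems.EIHFluxBalanceInertialRecessionSlavingFarFieldSpinRowsA
import Summits.FinalStateConjecture.FinalStateConjecture.Theorems.EIHFluxBalanceInertialRecessionSlavingFarFieldSpinRowsB
import Summits.FinalStateConjecture.FinalStateConjecture.Theorems.EIHFluxBalanceInertialRecessionSlavingFarFieldKernel

/-!
# Route EIHFluxBalance — `InertialRecession` (E′), K1 / stub `stub_coerMomKernel` (Bk), far field, part F5: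
# the two far-field kernel steps of Bk, packaged (rows + triangular eliminations)

Helper file for the crux `stmt-FinalStateConjecture-17403`. For `L = boost((2s/(1+s²))e₁)`, `0 ≤ s < 1`:
* `farField_boostPart_eq_zero` — if the flat momentum rows of Bk's `Var` (general skew `A = (b, ω)`, `d = 0`) vanish at
  `(3e₁, j=1), (3e₂, j=2), (3e₃, j=3)`, then `b = 0` (order `R⁻³` of Bk);
* `farField_translationSpin_eq_zero` — if `b = 0` and the rows of `Var` (rotation `ω`, translation `d`) plus `c ≠ 0` times the
  rows of the boosted Lense–Thirring field with spin `σ = e₃ × ω = (−ω₂, ω₁, 0)` vanish at `(3e₁, j=1,2,3), (−3e₂, j=1),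
  (−3e₃, j=1,2)`, then `d⃗ = 0` and `ω₁ = ω₂ = 0` (order `R⁻⁴` of Bk; `c` absorbs the lead's normalisation `a·M·…`).
Assembled from `…SlavingFarFieldRowsA/B`, `…SpinRowsA/B`, `…Kernel`. No definitions, no `sorry`. [folklore]
-/

set_option linter.dupNamespace false
set_option maxSynthPendingDepth 6
set_option synthInstance.maxHeartbeats 200000

noncomputable section

open scoped Topology InnerProductSpace
open Filter Set Function Literature.Geometry.Lorentzian Literature.Geometry.Lorentzian.Schwarzschild

namespace Summit.FinalStateConjecture.FinalStateConjecture.Theorems.SublinearIsFree.Slaving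

/-- **Order `R⁻³` of Bk: the boost part vanishes.** [folklore] -/
theorem farField_boostPart_eq_zero {s : ℝ} (hs0 : 0 ≤ s) (hs1 : s < 1)
    (hw : ‖((2 * s / (1 + s ^ 2)) • (EuclideanSpace.single 0 1 : E3))‖ < 1)
    (b₁ b₂ b₃ ω₁ ω₂ ω₃ : ℝ) (A : E4 →L[ℝ] E4)
    (hA : ∀ u : E4, A u = ![b₁ * u 1 + b₂ * u 2 + b₃ * u 3, b₁ * u 0 - ω₃ * u 2 + ω₂ * u 3,
      b₂ * u 0 + ω₃ * u 1 - ω₁ * u 3, b₃ * u 0 - ω₂ * u 1 + ω₁ * u 2])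
    (d : E4) (hd : d = 0) (V : E4 → E4 →L[ℝ] E4 →L[ℝ] ℝ)
    (hV : ∀ z, V z =
      (fderiv ℝ (Kerr.bilin 1 0) (poincareInv (Lorentz.boost ((2 * s / (1 + s ^ 2)) • (EuclideanSpace.single 0 1 : E3)) hw) 0 z) (A (poincareInv (Lorentz.boost ((2 * s / (1 + s ^ 2)) • (EuclideanSpace.single 0 1 : E3)) hw) 0 z) + d)).bilinearComp
          ((((Lorentz.boost ((2 * s / (1 + s ^ 2)) • (EuclideanSpace.single 0 1 : E3)) hw) : E4 ≃L[ℝ] E4).symm : E4 →L[ℝ] E4)) ((((Lorentz.boost ((2 * s / (1 + s ^ 2)) • (EuclideanSpace.single 0 1 : E3)) hw) : E4 ≃L[ℝ] E4).symm : E4 →L[ℝ] E4)) +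
        (Kerr.bilin 1 0 (poincareInv (Lorentz.boost ((2 * s / (1 + s ^ 2)) • (EuclideanSpace.single 0 1 : E3)) hw) 0 z)).bilinearComp
          (A.comp ((((Lorentz.boost ((2 * s / (1 + s ^ 2)) • (EuclideanSpace.single 0 1 : E3)) hw) : E4 ≃L[ℝ] E4).symm : E4 →L[ℝ] E4))) ((((Lorentz.boost ((2 * s / (1 + s ^ 2)) • (EuclideanSpace.single 0 1 : E3)) hw) : E4 ≃L[ℝ] E4).symm : E4 →L[ℝ] E4)) +
        (Kerr.bilin 1 0 (poincareInv (Lorentz.boost ((2 * s / (1 + s ^ 2)) • (EuclideanSpace.single 0 1 : E3)) hw) 0 z)).bilinearComp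
          ((((Lorentz.boost ((2 * s / (1 + s ^ 2)) • (EuclideanSpace.single 0 1 : E3)) hw) : E4 ≃L[ℝ] E4).symm : E4 →L[ℝ] E4)) (A.comp ((((Lorentz.boost ((2 * s / (1 + s ^ 2)) • (EuclideanSpace.single 0 1 : E3)) hw) : E4 ≃L[ℝ] E4).symm : E4 →L[ℝ] E4))))
    (hP1 : (∑ i : Fin 3, (fderiv ℝ V (E4.ofTimeSpace 0 ((3 : ℝ) • EuclideanSpace.single 0 1)) (E4.basisVector i.succ) (E4.basisVector i.succ) (E4.basisVector 1) -
        fderiv ℝ V (E4.ofTimeSpace 0 ((3 : ℝ) • EuclideanSpace.single 0 1)) (E4.basisVector 1) (E4.basisVector i.succ) (E4.basisVector i.succ))) = 0)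
    (hQ2 : (∑ i : Fin 3, (fderiv ℝ V (E4.ofTimeSpace 0 ((3 : ℝ) • EuclideanSpace.single 1 1)) (E4.basisVector i.succ) (E4.basisVector i.succ) (E4.basisVector 2) -
        fderiv ℝ V (E4.ofTimeSpace 0 ((3 : ℝ) • EuclideanSpace.single 1 1)) (E4.basisVector 2) (E4.basisVector i.succ) (E4.basisVector i.succ))) = 0)
    (hA3 : (∑ i : Fin 3, (fderiv ℝ V (E4.ofTimeSpace 0 ((3 : ℝ) • EuclideanSpace.single 2 1)) (E4.basisVector i.succ) (E4.basisVector i.succ) (E4.basisVector 3) -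
        fderiv ℝ V (E4.ofTimeSpace 0 ((3 : ℝ) • EuclideanSpace.single 2 1)) (E4.basisVector 3) (E4.basisVector i.succ) (E4.basisVector i.succ))) = 0) :
    b₁ = 0 ∧ b₂ = 0 ∧ b₃ = 0 := by
  have hs : |s| < 1 := abs_lt.2 ⟨by linarith, hs1⟩
  have hd' : d = ![(0 : ℝ), 0, 0, 0] := by
    rw [hd]; funext μ; fin_cases μ <;> simp
  rw [farField_row_P1 hs hw b₁ b₂ b₃ ω₁ ω₂ ω₃ 0 0 0 0 A hA d hd' V hV] at hP1
  rw [farField_row_Q2 hs hw b₁ b₂ b₃ ω₁ ω₂ ω₃ 0 0 0 0 A hA d hd' V hV] at hQ2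
  rw [farField_row_A3 hs hw b₁ b₂ b₃ ω₁ ω₂ ω₃ 0 0 0 0 A hA d hd' V hV] at hA3
  simp only [mul_zero, sub_zero] at hP1 hQ2 hA3
  exact farField_boostKernel hs0 hs1 hP1 hQ2 hA3

/-- **Order `R⁻⁴` of Bk: translations and the tilt of the spin axis vanish.** [folklore] -/
theorem farField_translationSpin_eq_zero {s c : ℝ} (hs0 : 0 ≤ s) (hs1 : s < 1) (hc : c ≠ 0)
    (hw : ‖((2 * s / (1 + s ^ 2)) • (EuclideanSpace.single 0 1 : E3))‖ < 1)
    (ω₁ ω₂ ω₃ d₀ d₁ d₂ d₃ : ℝ) (A : E4 →L[ℝ] E4)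
    (hA : ∀ u : E4, A u = ![0 * u 1 + 0 * u 2 + 0 * u 3, 0 * u 0 - ω₃ * u 2 + ω₂ * u 3,
      0 * u 0 + ω₃ * u 1 - ω₁ * u 3, 0 * u 0 - ω₂ * u 1 + ω₁ * u 2])
    (d : E4) (hd : d = ![d₀, d₁, d₂, d₃]) (V : E4 → E4 →L[ℝ] E4 →L[ℝ] ℝ)
    (hV : ∀ z, V z =
      (fderiv ℝ (Kerr.bilin 1 0) (poincareInv (Lorentz.boost ((2 * s / (1 + s ^ 2)) • (EuclideanSpace.single 0 1 : E3)) hw) 0 z) (A (poincareInv (Lorentz.boost ((2 * s / (1 + s ^ 2)) • (EuclideanSpace.single 0 1 : E3)) hw) 0 z) + d)).bilinearComp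
          ((((Lorentz.boost ((2 * s / (1 + s ^ 2)) • (EuclideanSpace.single 0 1 : E3)) hw) : E4 ≃L[ℝ] E4).symm : E4 →L[ℝ] E4)) ((((Lorentz.boost ((2 * s / (1 + s ^ 2)) • (EuclideanSpace.single 0 1 : E3)) hw) : E4 ≃L[ℝ] E4).symm : E4 →L[ℝ] E4)) +
        (Kerr.bilin 1 0 (poincareInv (Lorentz.boost ((2 * s / (1 + s ^ 2)) • (EuclideanSpace.single 0 1 : E3)) hw) 0 z)).bilinearComp
          (A.comp ((((Lorentz.boost ((2 * s / (1 + s ^ 2)) • (EuclideanSpace.single 0 1 : E3)) hw) : E4 ≃L[ℝ] E4).symm : E4 →L[ℝ] E4))) ((((Lorentz.boost ((2 * s / (1 + s ^ 2)) • (EuclideanSpace.single 0 1 : E3)) hw) : E4 ≃L[ℝ] E4).symm : E4 →L[ℝ] E4)) +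
        (Kerr.bilin 1 0 (poincareInv (Lorentz.boost ((2 * s / (1 + s ^ 2)) • (EuclideanSpace.single 0 1 : E3)) hw) 0 z)).bilinearComp
          ((((Lorentz.boost ((2 * s / (1 + s ^ 2)) • (EuclideanSpace.single 0 1 : E3)) hw) : E4 ≃L[ℝ] E4).symm : E4 →L[ℝ] E4)) (A.comp ((((Lorentz.boost ((2 * s / (1 + s ^ 2)) • (EuclideanSpace.single 0 1 : E3)) hw) : E4 ≃L[ℝ] E4).symm : E4 →L[ℝ] E4))))
    (S : E4 → E4 → E4 → ℝ)
    (hS : ∀ z u w : E4, S z u w =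
      2 / E4.spatialNorm (((Lorentz.boost ((2 * s / (1 + s ^ 2)) • (EuclideanSpace.single 0 1 : E3)) hw) : E4 ≃L[ℝ] E4).symm z) ^ 3 *
        (ell (((Lorentz.boost ((2 * s / (1 + s ^ 2)) • (EuclideanSpace.single 0 1 : E3)) hw) : E4 ≃L[ℝ] E4).symm z) (((Lorentz.boost ((2 * s / (1 + s ^ 2)) • (EuclideanSpace.single 0 1 : E3)) hw) : E4 ≃L[ℝ] E4).symm u) * sdot (((Lorentz.boost ((2 * s / (1 + s ^ 2)) • (EuclideanSpace.single 0 1 : E3)) hw) : E4 ≃L[ℝ] E4).symm z) (WithLp.toLp 2 ![(0 : ℝ), ω₁ * (((Lorentz.boost ((2 * s / (1 + s ^ 2)) • (EuclideanSpace.single 0 1 : E3)) hw) : E4 ≃L[ℝ] E4).symm w) 3 - 0 * (((Lorentz.boost ((2 * s / (1 + s ^ 2)) • (EuclideanSpace.single 0 1 : E3)) hw) : E4 ≃L[ℝ] E4).symm w) 2, 0 * (((Lorentz.boost ((2 * s / (1 + s ^ 2)) • (EuclideanSpace.single 0 1 : E3)) hw) : E4 ≃L[ℝ] E4).symm w) 1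 - -ω₂ * (((Lorentz.boost ((2 * s / (1 + s ^ 2)) • (EuclideanSpace.single 0 1 : E3)) hw) : E4 ≃L[ℝ] E4).symm w) 3, -ω₂ * (((Lorentz.boost ((2 * s / (1 + s ^ 2)) • (EuclideanSpace.single 0 1 : E3)) hw) : E4 ≃L[ℝ] E4).symm w) 2 - ω₁ * (((Lorentz.boost ((2 * s / (1 + s ^ 2)) • (EuclideanSpace.single 0 1 : E3)) hw) : E4 ≃L[ℝ] E4).symm w) 1]) +
          sdot (((Lorentz.boost ((2 * s / (1 + s ^ 2)) • (EuclideanSpace.single 0 1 : E3)) hw) : E4 ≃L[ℝ] E4).symm z) (WithLp.toLp 2 ![(0 : ℝ), ω₁ * (((Lorentz.boost ((2 * s / (1 + s ^ 2)) • (EuclideanSpace.single 0 1 : E3)) hw) : E4 ≃L[ℝ] E4).symm u) 3 - 0 * (((Lorentz.boost ((2 * s / (1 + s ^ 2)) • (EuclideanSpace.single 0 1 : E3)) hw) : E4 ≃L[ℝ] E4).symm u) 2, 0 * (((Lorentz.boost ((2 * s / (1 + s ^ 2)) • (EuclideanSpace.single 0 1 : E3)) hw) : E4 ≃L[ℝ]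 E4).symm u) 1 - -ω₂ * (((Lorentz.boost ((2 * s / (1 + s ^ 2)) • (EuclideanSpace.single 0 1 : E3)) hw) : E4 ≃L[ℝ] E4).symm u) 3, -ω₂ * (((Lorentz.boost ((2 * s / (1 + s ^ 2)) • (EuclideanSpace.single 0 1 : E3)) hw) : E4 ≃L[ℝ] E4).symm u) 2 - ω₁ * (((Lorentz.boost ((2 * s / (1 + s ^ 2)) • (EuclideanSpace.single 0 1 : E3)) hw) : E4 ≃L[ℝ] E4).symm u) 1]) * ell (((Lorentz.boost ((2 * s / (1 + s ^ 2)) • (EuclideanSpace.single 0 1 : E3)) hw) : E4 ≃L[ℝ] E4).symm z) (((Lorentz.boost ((2 * s / (1 + s ^ 2)) • (EuclideanSpace.single 0 1 : E3)) hw) : E4 ≃L[ℝ] E4).symm w)))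
    (hP1 : (∑ i : Fin 3, (fderiv ℝ V (E4.ofTimeSpace 0 ((3 : ℝ) • EuclideanSpace.single 0 1)) (E4.basisVector i.succ) (E4.basisVector i.succ) (E4.basisVector 1) -
        fderiv ℝ V (E4.ofTimeSpace 0 ((3 : ℝ) • EuclideanSpace.single 0 1)) (E4.basisVector 1) (E4.basisVector i.succ) (E4.basisVector i.succ))) + c * (∑ i : Fin 3, (fderiv ℝ (fun z ↦ S z (E4.basisVector i.succ) (E4.basisVector 1)) (E4.ofTimeSpace 0 ((3 : ℝ) • EuclideanSpace.single 0 1)) (E4.basisVector i.succ) -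
        fderiv ℝ (fun z ↦ S z (E4.basisVector i.succ) (E4.basisVector i.succ)) (E4.ofTimeSpace 0 ((3 : ℝ) • EuclideanSpace.single 0 1)) (E4.basisVector 1))) = 0)
    (hP2 : (∑ i : Fin 3, (fderiv ℝ V (E4.ofTimeSpace 0 ((3 : ℝ) • EuclideanSpace.single 0 1)) (E4.basisVector i.succ) (E4.basisVector i.succ) (E4.basisVector 2) -
        fderiv ℝ V (E4.ofTimeSpace 0 ((3 : ℝ) • EuclideanSpace.single 0 1)) (E4.basisVector 2) (E4.basisVector i.succ) (E4.basisVector i.succ))) + c * (∑ i : Fin 3, (fderiv ℝ (fun z ↦ S z (E4.basisVector i.succ) (E4.basisVector 2)) (E4.ofTimeSpace 0 ((3 : ℝ) • EuclideanSpace.single 0 1)) (E4.basisVector i.succ) -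
        fderiv ℝ (fun z ↦ S z (E4.basisVector i.succ) (E4.basisVector i.succ)) (E4.ofTimeSpace 0 ((3 : ℝ) • EuclideanSpace.single 0 1)) (E4.basisVector 2))) = 0)
    (hP3 : (∑ i : Fin 3, (fderiv ℝ V (E4.ofTimeSpace 0 ((3 : ℝ) • EuclideanSpace.single 0 1)) (E4.basisVector i.succ) (E4.basisVector i.succ) (E4.basisVector 3) -
        fderiv ℝ V (E4.ofTimeSpace 0 ((3 : ℝ) • EuclideanSpace.single 0 1)) (E4.basisVector 3) (E4.basisVector i.succ) (E4.basisVector i.succ))) + c * (∑ i : Fin 3, (fderiv ℝ (fun z ↦ S z (E4.basisVector i.succ) (E4.basisVector 3)) (E4.ofTimeSpace 0 ((3 : ℝ) • EuclideanSpace.single 0 1)) (E4.basisVector i.succ) -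
        fderiv ℝ (fun z ↦ S z (E4.basisVector i.succ) (E4.basisVector i.succ)) (E4.ofTimeSpace 0 ((3 : ℝ) • EuclideanSpace.single 0 1)) (E4.basisVector 3))) = 0)
    (hQ1 : (∑ i : Fin 3, (fderiv ℝ V (E4.ofTimeSpace 0 ((-3 : ℝ) • EuclideanSpace.single 1 1)) (E4.basisVector i.succ) (E4.basisVector i.succ) (E4.basisVector 1) -
        fderiv ℝ V (E4.ofTimeSpace 0 ((-3 : ℝ) • EuclideanSpace.single 1 1)) (E4.basisVector 1) (E4.basisVector i.succ) (E4.basisVector i.succ))) + c * (∑ i : Fin 3, (fderiv ℝ (fun z ↦ S z (E4.basisVector i.succ) (E4.basisVector 1)) (E4.ofTimeSpace 0 ((-3 : ℝ) • EuclideanSpace.single 1 1)) (E4.basisVector i.succ) -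
        fderiv ℝ (fun z ↦ S z (E4.basisVector i.succ) (E4.basisVector i.succ)) (E4.ofTimeSpace 0 ((-3 : ℝ) • EuclideanSpace.single 1 1)) (E4.basisVector 1))) = 0)
    (hA1 : (∑ i : Fin 3, (fderiv ℝ V (E4.ofTimeSpace 0 ((-3 : ℝ) • EuclideanSpace.single 2 1)) (E4.basisVector i.succ) (E4.basisVector i.succ) (E4.basisVector 1) -
        fderiv ℝ V (E4.ofTimeSpace 0 ((-3 : ℝ) • EuclideanSpace.single 2 1)) (E4.basisVector 1) (E4.basisVector i.succ) (E4.basisVector i.succ))) + c * (∑ i : Fin 3, (fderiv ℝ (fun z ↦ S z (E4.basisVector i.succ) (E4.basisVector 1)) (E4.ofTimeSpace 0 ((-3 : ℝ) • EuclideanSpace.single 2 1)) (E4.basisVector i.succ) -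
        fderiv ℝ (fun z ↦ S z (E4.basisVector i.succ) (E4.basisVector i.succ)) (E4.ofTimeSpace 0 ((-3 : ℝ) • EuclideanSpace.single 2 1)) (E4.basisVector 1))) = 0)
    (hA2 : (∑ i : Fin 3, (fderiv ℝ V (E4.ofTimeSpace 0 ((-3 : ℝ) • EuclideanSpace.single 2 1)) (E4.basisVector i.succ) (E4.basisVector i.succ) (E4.basisVector 2) -
        fderiv ℝ V (E4.ofTimeSpace 0 ((-3 : ℝ) • EuclideanSpace.single 2 1)) (E4.basisVector 2) (E4.basisVector i.succ) (E4.basisVector i.succ))) + c * (∑ i : Fin 3, (fderiv ℝ (fun z ↦ S z (E4.basisVector i.succ) (E4.basisVector 2)) (E4.ofTimeSpace 0 ((-3 : ℝ) • EuclideanSpace.single 2 1)) (E4.basisVector i.succ) -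
        fderiv ℝ (fun z ↦ S z (E4.basisVector i.succ) (E4.basisVector i.succ)) (E4.ofTimeSpace 0 ((-3 : ℝ) • EuclideanSpace.single 2 1)) (E4.basisVector 2))) = 0) :
    d₁ = 0 ∧ d₂ = 0 ∧ d₃ = 0 ∧ ω₁ = 0 ∧ ω₂ = 0 := by
  have hs : |s| < 1 := abs_lt.2 ⟨by linarith, hs1⟩
  rw [farField_row_P1 hs hw 0 0 0 ω₁ ω₂ ω₃ d₀ d₁ d₂ d₃ A hA d hd V hV, farField_spinRow_P1 hs hw (-ω₂) ω₁ 0 S hS] at hP1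
  rw [farField_row_P2 hs hw 0 0 0 ω₁ ω₂ ω₃ d₀ d₁ d₂ d₃ A hA d hd V hV, farField_spinRow_P2 hs hw (-ω₂) ω₁ 0 S hS] at hP2
  rw [farField_row_P3 hs hw 0 0 0 ω₁ ω₂ ω₃ d₀ d₁ d₂ d₃ A hA d hd V hV, farField_spinRow_P3 hs hw (-ω₂) ω₁ 0 S hS] at hP3
  rw [farField_row_Qm1 hs hw 0 0 0 ω₁ ω₂ ω₃ d₀ d₁ d₂ d₃ A hA d hd V hV, farField_spinRow_Qm1 hs hw (-ω₂) ω₁ 0 S hS] at hQ1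
  rw [farField_row_Am1 hs hw 0 0 0 ω₁ ω₂ ω₃ d₀ d₁ d₂ d₃ A hA d hd V hV, farField_spinRow_Am1 hs hw (-ω₂) ω₁ 0 S hS] at hA1
  rw [farField_row_Am2 hs hw 0 0 0 ω₁ ω₂ ω₃ d₀ d₁ d₂ d₃ A hA d hd V hV, farField_spinRow_Am2 hs hw (-ω₂) ω₁ 0 S hS] at hA2
  simp only [mul_zero, zero_sub] at hP1 hP2 hP3 hQ1 hA1 hA2
  obtain ⟨h1, h2, h3, h4, h5, -⟩ := farField_translationSpinKernel (a := c) hs0 hs1 hc (d₁ := d₁) (d₂ := d₂) (d₃ := d₃)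
    (σ₁ := -ω₂) (σ₂ := ω₁) (σ₃ := 0) (by linarith [hP1]) (by linarith [hP2]) (by linarith [hP3]) (by linarith [hQ1])
    (by linarith [hA1]) (by linarith [hA2])
  exact ⟨h1, h2, h3, by linarith, by linarith⟩

/-- Registered carrier `slaving_farFieldBk_slaving12` of the crux item (= `farField_boostPart_eq_zero`). [folklore] -/
theorem slaving_farFieldBk_slaving12 : open Literature.Geometry.Lorentzian Literature.Geometry.Lorentzian.Schwarzschild in ∀ {s : ℝ} (hs0 : 0 ≤ s) (hs1 : s < 1) (hw : ‖((2 * s / (1 + s ^ 2)) • (EuclideanSpace.single 0 1 : E3))‖ < 1) (b₁ b₂ b₃ ω₁ ω₂ ω₃ : ℝ) (A : E4 →L[ℝ] E4) (hA : ∀ u : E4, A u = ![b₁ * u 1 + b₂ * u 2 + b₃ * u 3, b₁ * u 0 - ω₃ * u 2 + ω₂ * u 3, b₂ * u 0 + ω₃ * u 1 - ω₁ * u 3, b₃ * u 0 - ω₂ * u 1 + ω₁ * u 2]) (d : E4) (hd : d = 0) (V : E4 → E4 →L[ℝ] E4 →L[ℝ] ℝ) (hV : ∀ z, V z = (fderiv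 ℝ (Kerr.bilin 1 0) (poincareInv (Lorentz.boost ((2 * s / (1 + s ^ 2)) • (EuclideanSpace.single 0 1 : E3)) hw) 0 z) (A (poincareInv (Lorentz.boost ((2 * s / (1 + s ^ 2)) • (EuclideanSpace.single 0 1 : E3)) hw) 0 z) + d)).bilinearComp ((((Lorentz.boost ((2 * s / (1 + s ^ 2)) • (EuclideanSpace.single 0 1 : E3)) hw) : E4 ≃L[ℝ] E4).symm : E4 →L[ℝ] E4)) ((((Lorentz.boost ((2 * s / (1 + s ^ 2)) • (EuclideanSpace.single 0 1 : E3)) hw) : E4 ≃L[ℝ] E4).symm : E4 →L[ℝ] E4)) + (Kerr.bilin 1 0 (poincareInv (Lorentz.boost ((2 * s / (1 + s ^ 2)) • (EuclideanSpace.single 0 1 : E3)) hw) 0 z)).bilinearComp (A.comp ((((Lorentz.boost ((2 * s / (1 + s ^ 2)) • (EuclideanSpace.single 0 1 : E3)) hw) : E4 ≃L[ℝ] E4).symm : E4 →L[ℝ] E4))) ((((Lorentz.boost ((2 * s / (1 + s ^ 2)) • (EuclideanSpace.single 0 1 : E3)) hw) : E4 ≃L[ℝ] E4).symm : E4 →L[ℝ]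 E4)) + (Kerr.bilin 1 0 (poincareInv (Lorentz.boost ((2 * s / (1 + s ^ 2)) • (EuclideanSpace.single 0 1 : E3)) hw) 0 z)).bilinearComp ((((Lorentz.boost ((2 * s / (1 + s ^ 2)) • (EuclideanSpace.single 0 1 : E3)) hw) : E4 ≃L[ℝ] E4).symm : E4 →L[ℝ] E4)) (A.comp ((((Lorentz.boost ((2 * s / (1 + s ^ 2)) • (EuclideanSpace.single 0 1 : E3)) hw) : E4 ≃L[ℝ] E4).symm : E4 →L[ℝ] E4)))) (hP1 : (∑ i : Fin 3, (fderiv ℝ V (E4.ofTimeSpace 0 ((3 : ℝ) • EuclideanSpace.single 0 1)) (E4.basisVector i.succ) (E4.basisVector i.succ) (E4.basisVector 1) - fderiv ℝ V (E4.ofTimeSpace 0 ((3 : ℝ) • EuclideanSpace.single 0 1)) (E4.basisVector 1) (E4.basisVector i.succ) (E4.basisVector i.succ))) = 0) (hQ2 : (∑ i : Fin 3, (fderiv ℝ V (E4.ofTimeSpace 0 ((3 : ℝ) • EuclideanSpace.single 1 1)) (E4.basisVector i.succ) (E4.basisVector i.succ) (E4.basisVector 2) - fderiv ℝ V (E4.ofTimeSpace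 0 ((3 : ℝ) • EuclideanSpace.single 1 1)) (E4.basisVector 2) (E4.basisVector i.succ) (E4.basisVector i.succ))) = 0) (hA3 : (∑ i : Fin 3, (fderiv ℝ V (E4.ofTimeSpace 0 ((3 : ℝ) • EuclideanSpace.single 2 1)) (E4.basisVector i.succ) (E4.basisVector i.succ) (E4.basisVector 3) - fderiv ℝ V (E4.ofTimeSpace 0 ((3 : ℝ) • EuclideanSpace.single 2 1)) (E4.basisVector 3) (E4.basisVector i.succ) (E4.basisVector i.succ))) = 0), b₁ = 0 ∧ b₂ = 0 ∧ b₃ = 0 :=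
  farField_boostPart_eq_zero

end Summit.FinalStateConjecture.FinalStateConjecture.Theorems.SublinearIsFree.Slaving
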